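import Mathlib.Data.Real.Basic
import Mathlib.Tactic.Linarith
import Mathlib.Tactic.Ring
import Summits.CriticalPhenomena.PercolationContinuityZ3.Theorems.PercNearOneGluingNoHeavyLowerTailThreePointLBSwitchingCertificate
import HarnessLib

/-!
# `NoHeavyLowerTail` (stmt-CriticalPhenomena-4575) — `AG⁺` (Aas–Gladkov with the cubic term) by four switchings, I:
# the finite certificate check and the cubic identity

Support file (prover prim-ineq-prove-3; `--supports stmt-CriticalPhenomena-4575`).  No named facts, no sorries; graph-free.

The two graph-free ingredients of the proof of
`AG⁺ :  q·t − (u_ab u_ac + u_ab u_bc + u_ac u_bc) − u_ab u_ac u_bc ≥ 0`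
(prim-ineq-prove-3, THEOREM-AGPLUS-3COPY.md, certificate "I4" = four programs with `±1` potentials, found 2026-08-20 by the
extended three-copy switching LP of prim-e3grp-switch-1 (reveal-only steps + one `o_X` feature, kit j084442/j084552) after the
four-copy certificate of THEOREM-AGPLUS-4COPY.md):
* `certB_nonpos` / `certP_nonpos` — the pointwise lemma in abstract form: after the sealed-cluster rewriting rules of
  `…ThreePointLBSwitching`, the sum `S = λ₀ + Σᵢ λᵢ∘Φᵢ` is a signed sum of eight indicator monomials in SIXTEEN atomic connection
  statements (`xab xac xbc` in copy `X`, `yab ybc` in `Y`, `zab zac zbc` in `Z`, the avoiding paths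
  `yp = [b~c by Y-pairs avoiding cl X a]`, `zp = [a~b by Z-pairs avoiding cl X c]`, and six connections inside the partially exchanged
  outputs `n2 m2b m2c n3 m3a m3c`), subject to fifteen implications supplied by F1–F4/F3′/transitivity; on all `2¹⁶` Boolean
  patterns satisfying them the sum is `≤ 0` (`decide`, two slices).
* `cert_identity` — with `q + u_a + u_b + u_c + t = 1` the eight expectations sum to `−AG⁺ = −(qt − e₂(u) − e₃(u))`.
-/

noncomputable section

namespace Summit.CriticalPhenomena.PercolationContinuityZ3.Theorems

namespace AGPlusSwitching

open ThreePointLB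

/-- The pointwise certificate of `AG⁺` as a function of the 16 Boolean atoms (see `certI4_nonpos` of file II); the `∧/∨` structure
is exactly the one produced by the rewriting `simp` there. [this work] -/
def certB (xab xac xbc yab ybc zab zac zbc yp zp n2 m2b m2c n3 m3a m3c : Bool) : ℤ :=
  - bI ((!xab && (!xac && !xbc)) && (!ybc && !zab))
  + bI ((xbc && !xab) && (!ybc && zab))
  - bI ((xbc && !xab) && (!ybc && (!zab && (!zac && !zbc))))
  - bI ((xac && !xab) && ((!yab && !ybc) && (zbc && !zab)))
  - bI ((!xab && (!xac && !((xab && xac) || (!xab && yp)))) && !(!zab && !zbc))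
  + bI (!n2 && (!ybc && (!m2b && !m2c)))
  + bI (!n3 && ((!m3a && !m3c) && (zbc && !zab)))
  + bI ((!m3a && !m3c) && (((xac && xbc) || (!xac && zp)) && !xac))

set_option synthInstance.maxHeartbeats 400000 in
set_option synthInstance.maxSize 4096 in
set_option maxHeartbeats 4000000 in
/-- Case `xab = false` of `certB_nonpos` (`2¹⁵` patterns, `decide`). [this work] -/
theorem certB_nonpos_f : ∀ xac xbc yab ybc zab zac zbc yp zp n2 m2b m2c n3 m3a m3c : Bool,
    (false = true → xac = true → xbc = true) → (xac = true → xbc = true → false = true) →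
    (yp = true → ybc = true) → (zp = true → zab = true) → (xac = false → zp = true → xbc = false) →
    (xbc = true → m2b = zab) → (xbc = true → m2c = zac) → (false = true → n2 = true) →
    (xbc = false → xac = true → m2c = true) → (zp = true → m2b = true) →
    (xac = true → m3a = yab) → (xac = true → m3c = ybc) → (xbc = true → n3 = true) →
    (xac = false → false = true → m3a = true) → (yp = true → m3c = true) →
    certB false xac xbc yab ybc zab zac zbc yp zp n2 m2b m2c n3 m3a m3c ≤ 0 := by
  decide +kernel

set_option synthInstance.maxHeartbeats 400000 in
set_option synthInstance.maxSize 4096 in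
set_option maxHeartbeats 4000000 in
/-- Case `xab = true` of `certB_nonpos` (`2¹⁵` patterns, `decide`). [this work] -/
theorem certB_nonpos_t : ∀ xac xbc yab ybc zab zac zbc yp zp n2 m2b m2c n3 m3a m3c : Bool,
    (true = true → xac = true → xbc = true) → (xac = true → xbc = true → true = true) →
    (yp = true → ybc = true) → (zp = true → zab = true) → (xac = false → zp = true → xbc = false) →
    (xbc = true → m2b = zab) → (xbc = true → m2c = zac) → (true = true → n2 = true) →
    (xbc = false → xac = true → m2c = true) → (zp = true → m2b = true) →
    (xac = true → m3a = yab) → (xac = true → m3c = ybc) → (xbc = true → n3 = true) →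
    (xac = false → true = true → m3a = true) → (yp = true → m3c = true) →
    certB true xac xbc yab ybc zab zac zbc yp zp n2 m2b m2c n3 m3a m3c ≤ 0 := by
  decide +kernel

/-- **The certificate is pointwise nonpositive** on every Boolean pattern of the sixteen atoms compatible with the fifteen implications
supplied by the cluster facts (`2¹⁶` cases in two slices). [this work] -/
theorem certB_nonpos : ∀ xab xac xbc yab ybc zab zac zbc yp zp n2 m2b m2c n3 m3a m3c : Bool,
    (xab = true → xac = true → xbc = true) → (xac = true → xbc = true → xab = true) →
    (yp = true → ybc = true) → (zp = true → zab = true) → (xac = false → zp = true → xbc = false) →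
    (xbc = true → m2b = zab) → (xbc = true → m2c = zac) → (xab = true → n2 = true) →
    (xbc = false → xac = true → m2c = true) → (zp = true → m2b = true) →
    (xac = true → m3a = yab) → (xac = true → m3c = ybc) → (xbc = true → n3 = true) →
    (xac = false → xab = true → m3a = true) → (yp = true → m3c = true) →
    certB xab xac xbc yab ybc zab zac zbc yp zp n2 m2b m2c n3 m3a m3c ≤ 0 := by
  intro xab
  cases xab
  · exact certB_nonpos_f
  · exact certB_nonpos_t

/-- **Pointwise lemma, propositional form**: for any sixteen propositions satisfying the fifteen implications, the certificate expression
is `≤ 0`. [this work] -/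
theorem certP_nonpos (xab xac xbc yab ybc zab zac zbc yp zp n2 m2b m2c n3 m3a m3c : Prop)
    (h1 : xab → xac → xbc) (h2 : xac → xbc → xab) (h3 : yp → ybc) (h4 : zp → zab) (h5 : ¬xac → zp → ¬xbc)
    (h6 : xbc → (m2b ↔ zab)) (h7 : xbc → (m2c ↔ zac)) (h8 : xab → n2) (h9 : ¬xbc → xac → m2c) (h10 : zp → m2b)
    (h11 : xac → (m3a ↔ yab)) (h12 : xac → (m3c ↔ ybc)) (h13 : xbc → n3) (h14 : ¬xac → xab → m3a) (h15 : yp → m3c) :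
    -pind ((¬xab ∧ ¬xac ∧ ¬xbc) ∧ ¬ybc ∧ ¬zab)
    + pind ((xbc ∧ ¬xab) ∧ ¬ybc ∧ zab)
    - pind ((xbc ∧ ¬xab) ∧ ¬ybc ∧ ¬zab ∧ ¬zac ∧ ¬zbc)
    - pind ((xac ∧ ¬xab) ∧ (¬yab ∧ ¬ybc) ∧ zbc ∧ ¬zab)
    - pind ((¬xab ∧ ¬xac ∧ ¬(xab ∧ xac ∨ ¬xab ∧ yp)) ∧ ¬(¬zab ∧ ¬zbc))
    + pind (¬n2 ∧ ¬ybc ∧ ¬m2b ∧ ¬m2c)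
    + pind (¬n3 ∧ (¬m3a ∧ ¬m3c) ∧ zbc ∧ ¬zab)
    + pind ((¬m3a ∧ ¬m3c) ∧ (xac ∧ xbc ∨ ¬xac ∧ zp) ∧ ¬xac) ≤ 0 := by
  classical
  have key := certB_nonpos (decide xab) (decide xac) (decide xbc) (decide yab) (decide ybc) (decide zab) (decide zac)
      (decide zbc) (decide yp) (decide zp) (decide n2) (decide m2b) (decide m2c) (decide n3) (decide m3a) (decide m3c)
      (by simpa only [decide_eq_true_eq] using h1) (by simpa only [decide_eq_true_eq] using h2)
      (by simpa only [decide_eq_true_eq] using h3) (by simpa only [decide_eq_true_eq] using h4)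
      (by simpa only [decide_eq_true_eq, decide_eq_false_iff_not] using h5)
      (by intro h; rw [decide_eq_true_eq] at h; exact (decide_eq_decide).2 (h6 h))
      (by intro h; rw [decide_eq_true_eq] at h; exact (decide_eq_decide).2 (h7 h))
      (by simpa only [decide_eq_true_eq] using h8)
      (by simpa only [decide_eq_true_eq, decide_eq_false_iff_not] using h9)
      (by simpa only [decide_eq_true_eq] using h10)
      (by intro h; rw [decide_eq_true_eq] at h; exact (decide_eq_decide).2 (h11 h))
      (by intro h; rw [decide_eq_true_eq] at h; exact (decide_eq_decide).2 (h12 h))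
      (by simpa only [decide_eq_true_eq] using h13)
      (by simpa only [decide_eq_true_eq, decide_eq_false_iff_not] using h14)
      (by simpa only [decide_eq_true_eq] using h15)
  rw [pind_eq_bI, pind_eq_bI, pind_eq_bI, pind_eq_bI, pind_eq_bI, pind_eq_bI, pind_eq_bI, pind_eq_bI]
  simp only [Bool.decide_and, Bool.decide_or, decide_not]
  unfold certB at key
  exact_mod_cast key

/-! ### The cubic identity -/

/-- The cubic identity `E[λ₀] + Σᵢ E[λᵢ] = −AG⁺` (IDENTITY (I) for certificate I4), as a polynomial identity in the five cell probabilities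
with `q + u_a + u_b + u_c + t = 1` (`u_a = μ(a|bc)`, `u_b = μ(ac|b)`, `u_c = μ(ab|c)`). [this work] -/
theorem cert_identity (q ua ub uc t : ℝ) (h : q + ua + ub + uc + t = 1) :
    -(q * (q + ub + uc) * (q + ua + ub)) + ua * (q + ub + uc) * (uc + t) - ua * (q + ub + uc) * q
      - ub * (q + ub) * ua - 1 * q * (1 - (q + ub)) + (q + ua + ub) * (q + ub + uc) * (q + ua)
      + (q + ub + uc) * (q + ub) * ua + 1 * (q + ub) * uc =
    -(q * t - (uc * ub + uc * ua + ub * ua) - uc * ub * ua) := by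
  have ht : t = 1 - q - ua - ub - uc := by linarith
  subst ht
  ring

end AGPlusSwitching

end Summit.CriticalPhenomena.PercolationContinuityZ3.Theorems

end
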